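import Summits.Ventures.PercRepro.RankLevelSetBiIndepUpSet
import Summits.Ventures.PercRepro.RankLevelSetBiIndepTruncate

/-! # RankLevelSetInOutTruncate — (IO) SURVIVES TRUNCATION: THE IN-OUT PROFILE OF `T_k M` FOR A FILTER `U` OF ITS
FLATS IS THE WINDOW `[#E − k, k]` OF THE IN-OUT PROFILE OF `M` FOR THE LIFTED FILTER, AND THE WINDOW KEEPS THE
NORMALIZED HALF RULE (night-1 g33; dossier §45.8)

The truncation `T_k M = truncateTo M k` (g24) is a quotient of `M`: `cl_M W ⊆ cl_T W` (**`closure_subset_truncateTo_closure`**: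
a `T`-basis of `W` with fewer than `k` elements is an `M`-basis, and a `T`-basis with `k` elements spans everything),
so `cl_T (cl_M W) = cl_T W`. For a family `U` up-closed among the flats of `T_k M` the LIFTED family
`liftCut M k U = {G : M.IsFlat G ∧ cl_T G ∈ U}` is up-closed among the flats of `M` (**`upSetFlats_liftCut`**) and
`cl_M W ∈ liftCut ↔ cl_T W ∈ U` (**`closure_mem_liftCut_iff`**). Hence the in-out profile of `(T_k M, U)` is the
profile of `(M, liftCut M k U)` inside the window `j ≤ k ∧ #E − j ≤ k` and `0` outside (**`inOutCount_truncateTo`**),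
with the bottom of the window empty (**`inOutCount_truncateTo_bottom`**: at level `#E − k` the complement has `k`
elements and `T`-spans `E ∈ U`) — and a window with empty bottom inherits the normalized half rule with parameter
`#E + 1` (**`SkewConv.normSkew_window`**). THEOREM **`biIndepInOutNormSkew_truncateTo`**:
`BiIndepInOutNormSkew M → BiIndepInOutNormSkew (truncateTo M k)`. With `RankLevelSetBoolInOutFree` (the Boolean (IO)
for the free matroid) this gives (IO) for EVERY UNIFORM MATROID `T_r (freeOn E)` with an arbitrary filter of flats.
Every declaration has a docstring; imports: the cell's own modules and Mathlib only. Axioms: standard. -/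

namespace PercRepro

/-! ## Sequences: a window with empty bottom keeps the normalized half rule -/

namespace SkewConv

/-- **The window** `[n − k, k]` of a sequence: `a j` for `j ≤ k ∧ n − j ≤ k`, `0` otherwise (the shape of every
profile of a truncation `T_k M`, `#E = n`). -/
def window (a : ℕ → ℕ) (n k : ℕ) (j : ℕ) : ℕ := if j ≤ k ∧ n - j ≤ k then a j else 0

/-- **A window with empty bottom keeps `NormSkew`**: if `NormSkew a (n + 1)` and the window vanishes at `n − k`,
then `NormSkew (window a n k) (n + 1)`. -/
lemma normSkew_window {a : ℕ → ℕ} {n k : ℕ} (h : NormSkew a (n + 1)) (hbot : window a n k (n - k) = 0) :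
    NormSkew (window a n k) (n + 1) := by
  intro i j hij hR
  unfold window at hbot ⊢
  by_cases hi : i ≤ k ∧ n - i ≤ k
  · rw [if_pos hi]
    rcases Nat.eq_zero_or_pos (a i) with h0 | hpos
    · rw [h0]; simp
    have hine : i ≠ n - k := by
      rintro rfl
      rw [if_pos hi] at hbot
      rw [hbot] at hpos
      exact lt_irrefl _ hpos
    have hi' : n - k < i := by omega
    have hj : j ≤ k ∧ n - j ≤ k := ⟨by omega, by omega⟩
    rw [if_pos hj]
    exact h i j hij hR
  · rw [if_neg hi]; simp

end SkewConv

open Set Matroid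

variable {α : Type} (M : Matroid α) [M.Finite]

/-! ## The truncation is a quotient -/

/-- A `T`-independent set is `M`-independent. -/
lemma indep_of_truncateTo_indep {k : ℕ} {I : Set α} (h : (truncateTo M k).Indep I) : M.Indep I :=
  ((truncateTo_indep_iff M k I).mp h).1

/-- **The truncation is a quotient of `M`**: `cl_M W ⊆ cl_T W`. -/
theorem closure_subset_truncateTo_closure (k : ℕ) (W : Set α) :
    M.closure W ⊆ (truncateTo M k).closure W := by
  -- reduce to `W ⊆ E`
  have hWE : M.closure W = M.closure (W ∩ M.E) := (M.closure_inter_ground W).symm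
  have hWE' : (truncateTo M k).closure W = (truncateTo M k).closure (W ∩ M.E) := by
    have := ((truncateTo M k).closure_inter_ground W).symm
    rwa [truncateTo_E] at this
  rw [hWE, hWE']
  set X := W ∩ M.E with hX
  have hXE : X ⊆ M.E := Set.inter_subset_right
  -- a `T`-basis of `X`
  obtain ⟨I, hI⟩ := (truncateTo M k).exists_isBasis X (by rw [truncateTo_E]; exact hXE)
  have hIind : (truncateTo M k).Indep I := hI.indep
  have hIM : M.Indep I := indep_of_truncateTo_indep M hIind
  have hIk : I.ncard ≤ k := ((truncateTo_indep_iff M k I).mp hIind).2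
  have hIX : I ⊆ X := hI.subset
  have hIfin : I.Finite := M.ground_finite.subset hIM.subset_ground
  rw [← hI.closure_eq_closure]
  rcases Nat.lt_or_ge I.ncard k with hlt | hge
  · -- `I` is an `M`-basis of `X`: every `x ∈ X ∖ I` has `insert x I` `M`-dependent
    have hIbasis : M.IsBasis I X := by
      refine hIM.isBasis_of_forall_insert hIX fun x hx => ?_
      by_contra hind
      rw [Matroid.not_dep_iff (by
        intro y hy
        rcases Set.mem_insert_iff.mp hy with rfl | hy
        · exact hXE hx.1
        · exact hIM.subset_ground hy)] at hind
      have hTind : (truncateTo M k).Indep (insert x I) := by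
        rw [truncateTo_indep_iff]
        refine ⟨hind, ?_⟩
        rw [Set.ncard_insert_of_notMem hx.2 hIfin]
        omega
      exact (hI.insert_dep hx).not_indep hTind
    rw [← hIbasis.closure_eq_closure]
    intro x hx
    rw [hIM.mem_closure_iff'] at hx
    rw [hIind.mem_closure_iff', truncateTo_E]
    exact ⟨hx.1, fun hT => hx.2 (indep_of_truncateTo_indep M hT)⟩
  · -- `#I = k`: every element of `E` is in `cl_T I`
    intro x hx
    have hxE : x ∈ M.E := M.closure_subset_ground _ hx
    rw [hIind.mem_closure_iff', truncateTo_E]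
    refine ⟨hxE, fun hT => ?_⟩
    by_contra hxI
    have := ((truncateTo_indep_iff M k _).mp hT).2
    rw [Set.ncard_insert_of_notMem hxI hIfin] at this
    omega

/-- `cl_T (cl_M W) = cl_T W`. -/
theorem truncateTo_closure_closure (k : ℕ) (W : Set α) :
    (truncateTo M k).closure (M.closure W) = (truncateTo M k).closure W := by
  apply le_antisymm
  · exact Matroid.closure_subset_closure_of_subset_closure (closure_subset_truncateTo_closure M k W)
  · have h1 : (truncateTo M k).closure W = (truncateTo M k).closure (W ∩ M.E) := by
      have := ((truncateTo M k).closure_inter_ground W).symm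
      rwa [truncateTo_E] at this
    rw [h1]
    apply (truncateTo M k).closure_subset_closure
    intro x hx
    rw [← M.closure_inter_ground W]
    exact M.subset_closure (W ∩ M.E) Set.inter_subset_right hx

/-! ## The lifted filter and the window -/

/-- **The lifted family**: the flats of `M` whose `T`-closure lies in `U`. -/
def liftCut (k : ℕ) (U : Set (Set α)) : Set (Set α) := {G | M.IsFlat G ∧ (truncateTo M k).closure G ∈ U}

/-- The lifted family is up-closed among the flats of `M` when `U` is up-closed among the flats of `T_k M`. -/
lemma upSetFlats_liftCut {k : ℕ} {U : Set (Set α)} (hU : UpSetFlats (truncateTo M k) U) :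
    UpSetFlats M (liftCut M k U) := by
  rintro F ⟨-, hF⟩ G hG hFG
  exact ⟨hG, hU _ hF _ (Matroid.isFlat_closure (M := truncateTo M k) (X := G)) ((truncateTo M k).closure_subset_closure hFG)⟩

/-- `cl_M W ∈ liftCut M k U ↔ cl_T W ∈ U`. -/
lemma closure_mem_liftCut_iff (k : ℕ) (U : Set (Set α)) (W : Set α) :
    M.closure W ∈ liftCut M k U ↔ (truncateTo M k).closure W ∈ U := by
  simp only [liftCut, Set.mem_setOf_eq, Matroid.isFlat_closure, true_and, truncateTo_closure_closure]

/-- **The in-out profile of the truncation is the window of the lifted profile.** -/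
theorem inOutCount_truncateTo (k : ℕ) (U : Set (Set α)) (j : ℕ) :
    inOutCount (truncateTo M k) U j = SkewConv.window (inOutCount M (liftCut M k U)) M.E.ncard k j := by
  unfold inOutCount SkewConv.window
  rw [biIndep_truncateTo]
  split_ifs with hw
  · congr 1
    ext W
    simp only [Set.mem_setOf_eq, truncateTo_E, closure_mem_liftCut_iff]
  · simp

/-- **The bottom of the window is empty**: at level `#E − k` the complement of a bi-independent set of `T_k M`
`T`-spans `E`, which is in `U` as soon as `U` is nonempty. -/
theorem inOutCount_truncateTo_bottom (k : ℕ) {U : Set (Set α)} (hU : UpSetFlats (truncateTo M k) U) :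
    inOutCount (truncateTo M k) U (M.E.ncard - k) = 0 := by
  unfold inOutCount
  haveI := truncateTo_finite M k
  rw [Set.ncard_eq_zero (hs := (biIndep_finite (truncateTo M k) _).subset fun _ h => h.1)]
  rw [Set.eq_empty_iff_forall_notMem]
  rintro W ⟨hW, hin, hout⟩
  apply hout
  have hWE : W ⊆ M.E := hW.1
  have hWcard : W.ncard = M.E.ncard - k := hW.2.1
  have hcind : (truncateTo M k).Indep (M.E \ W) := by
    have := hW.2.2.2; rwa [truncateTo_E] at this
  have hWfin : W.Finite := M.ground_finite.subset hWE
  -- `cl_T (E ∖ W) = E`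
  have hcl : (truncateTo M k).closure (M.E \ W) = M.E := by
    apply le_antisymm
    · have := (truncateTo M k).closure_subset_ground (M.E \ W)
      rwa [truncateTo_E] at this
    · intro x hxE
      rw [hcind.mem_closure_iff', truncateTo_E]
      refine ⟨hxE, fun hT => ?_⟩
      by_contra hxc
      have hxW : x ∈ W := by
        by_contra h; exact hxc ⟨hxE, h⟩
      have hWne : 1 ≤ W.ncard := Set.ncard_pos hWfin |>.mpr ⟨x, hxW⟩
      have hkn : k < M.E.ncard := by omega
      have hccard : (M.E \ W).ncard = k := by
        rw [Set.ncard_sdiff' hWE M.ground_finite, hWcard]; omega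
      have := ((truncateTo_indep_iff M k _).mp hT).2
      rw [Set.ncard_insert_of_notMem hxc (M.ground_finite.subset Set.sdiff_subset), hccard] at this
      omega
  rw [truncateTo_E, hcl]
  -- `E ∈ U` because `cl_T W ∈ U` and `E` is a flat of `T_k M`
  have hE : (truncateTo M k).IsFlat M.E := by
    have := (truncateTo M k).ground_isFlat; rwa [truncateTo_E] at this
  exact hU _ hin _ hE (by
    have := (truncateTo M k).closure_subset_ground W; rwa [truncateTo_E] at this)

/-- **(IO) SURVIVES TRUNCATION**: `BiIndepInOutNormSkew M → BiIndepInOutNormSkew (truncateTo M k)`. -/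
theorem biIndepInOutNormSkew_truncateTo (h : BiIndepInOutNormSkew M) (k : ℕ) :
    BiIndepInOutNormSkew (truncateTo M k) := by
  intro U hU
  rw [truncateTo_E]
  have hlift := h (liftCut M k U) (upSetFlats_liftCut M hU)
  have hbot := inOutCount_truncateTo_bottom M k hU
  rw [inOutCount_truncateTo] at hbot
  exact SkewConv.normSkew_congr (SkewConv.normSkew_window hlift hbot)
    fun j _ => (inOutCount_truncateTo M k U j).symm

end PercRepro
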